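import Literature.NumberTheory.Automorphic.BrandtModuleResidueCommutative
import HarnessLib

/-!
# Residual classification IV: no idempotents — the norm lattice `𝔓` and the ramified structure

Tenth layer of the proof files for the named fact `brandtMatrix_comm` of `BrandtModule.lean`
(Vignéras, LNM 800, III §5 ex. 5.8; Eichler 1973, II §6 Thm. 2). Residual substitute for
Vignéras II §1 (the maximal order of the local division algebra: unique maximal two-sided ideal
`P = {n ∈ p ℤ_p}`, `P² = p O`, `O / P ≅ 𝔽_{p²}`) for `A = O / p O` *without non-trivial
idempotents*:

* `IsZOrder.dvd_trdZ_of_no_idempotent` — then `p ∣ n(x) → p ∣ t(x)` (**(H)**; else `t⁻¹ res x`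
  is a non-trivial idempotent), so every `x` with `p ∣ n(x)` has `(res x)² = 0`;
* the **norm lattice** `IsZOrder.normLattice hO p hH = {x ∈ O | p ∣ n(x)}` (a two-sided
  lattice between `p O` and `O`, `1 ∉ 𝔓`, and `x ∉ 𝔓` is invertible modulo `p O`), its image
  `Z ⊆ A` (a two-sided ideal of square-zero elements) with `|Z| · [O : 𝔓] = p⁴`,
  `p ≤ |Z| < p⁴`;
* `card_normResidue_ne` — `|Z| = p` is impossible (`A = ℤ + Z` would be too small).

The case `|Z| = p²` (where `Z² = 0` by a kernel count and, for a maximal order, `𝔓² = p O` by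
**(M1)**, giving `IsResiduallyRamified`) is treated in `BrandtModuleResidueRamifiedSq.lean`, and
the case `|Z| = p³` is excluded in `BrandtModuleResidueRamifiedCubic.lean`, which also assembles
the dichotomy.

## References

* M.-F. Vignéras, *Arithmétique des algèbres de quaternions*, LNM 800 (1980), Ch. II §1
  (Thm. 1.1, Lemme 1.5: `P = Oπ`, `P² = pO`, corps résiduel à `p²` éléments) [VignerasLNM800].
-/

noncomputable section

open scoped Pointwise

universe u

namespace Literature.NumberTheory.Automorphic

namespace IsZOrder

variable {B : Type u} [Ring B] [Algebra ℚ B] [IsQuaternionAlgebra ℚ B] {O : Submodule ℤ B} {p : ℕ}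

/-! ### Additive subgroups of `A` of order `p` and `p²` -/

omit [Algebra ℚ B] [IsQuaternionAlgebra ℚ B] in
/-- An additive subgroup of `A` of order `p` is the line through any non-zero element. [folklore] -/
theorem addSubgroup_eq_zmultiples (hO : IsZOrder O) (hp : p.Prime) {H : AddSubgroup (hO.Residue p)}
    {c : hO.Residue p} (hc : c ∈ H) (hc0 : c ≠ 0) (hcard : Nat.card H = p) :
    ∀ a ∈ H, ∃ k : ℤ, a = (k : hO.Residue p) * c := by
  haveI : Fact p.Prime := ⟨hp⟩
  haveI : Finite H := Nat.finite_of_card_ne_zero (by rw [hcard]; exact hp.ne_zero)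
  have hord : addOrderOf c = p :=
    addOrderOf_eq_prime (by rw [nsmul_eq_mul, natCast_self_residue, zero_mul]) hc0
  have heq : AddSubgroup.zmultiples c = H :=
    AddSubgroup.eq_of_le_of_card_ge (AddSubgroup.zmultiples_le_of_mem hc)
      (by rw [hcard, Nat.card_zmultiples, hord])
  intro a ha
  rw [← heq, AddSubgroup.mem_zmultiples_iff] at ha
  obtain ⟨k, rfl⟩ := ha
  exact ⟨k, by rw [zsmul_eq_mul]⟩

omit [Algebra ℚ B] [IsQuaternionAlgebra ℚ B] in
/-- An additive subgroup of `A` of order `p²` is spanned by any two independent elements. [folklore] -/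
theorem exists_pair_of_mem_addSubgroup (hO : IsZOrder O) (hp : p.Prime) {H : AddSubgroup (hO.Residue p)}
    {c₁ c₂ : hO.Residue p} (hc₁ : c₁ ∈ H) (hc₂ : c₂ ∈ H)
    (hind : ∀ k l : ℤ, (k : hO.Residue p) * c₁ + (l : hO.Residue p) * c₂ = 0 → (p : ℤ) ∣ k ∧ (p : ℤ) ∣ l)
    (hcard : Nat.card H = p ^ 2) :
    ∀ a ∈ H, ∃ k l : ℤ, a = (k : hO.Residue p) * c₁ + (l : hO.Residue p) * c₂ := by
  classical
  haveI : NeZero p := ⟨hp.ne_zero⟩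
  haveI : Finite H := Nat.finite_of_card_ne_zero (by rw [hcard]; exact pow_ne_zero 2 hp.ne_zero)
  letI : Fintype H := Fintype.ofFinite _
  let g : ZMod p × ZMod p → H := fun kl =>
    ⟨((kl.1.val : ℤ) : hO.Residue p) * c₁ + ((kl.2.val : ℤ) : hO.Residue p) * c₂,
      H.add_mem (by rw [← zsmul_eq_mul]; exact H.zsmul_mem hc₁ _)
        (by rw [← zsmul_eq_mul]; exact H.zsmul_mem hc₂ _)⟩
  have hinj : Function.Injective g := by
    rintro ⟨k, l⟩ ⟨k', l'⟩ h
    have h' := congrArg Subtype.val h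
    simp only [g] at h'
    have h0 : (((k.val : ℤ) - k'.val : ℤ) : hO.Residue p) * c₁ +
        (((l.val : ℤ) - l'.val : ℤ) : hO.Residue p) * c₂ = 0 := by
      rw [Int.cast_sub, Int.cast_sub, sub_mul, sub_mul]
      have := sub_eq_zero.mpr h'
      rw [← this]
      abel
    obtain ⟨hk, hl⟩ := hind _ _ h0
    have hk' : ((k'.val : ℤ) : ZMod p) = ((k.val : ℤ) : ZMod p) :=
      (ZMod.intCast_eq_intCast_iff_dvd_sub _ _ p).mpr hk
    have hl' : ((l'.val : ℤ) : ZMod p) = ((l.val : ℤ) : ZMod p) :=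
      (ZMod.intCast_eq_intCast_iff_dvd_sub _ _ p).mpr hl
    simp only [Int.cast_natCast, ZMod.natCast_zmod_val] at hk' hl'
    rw [hk', hl']
  have hbij : Function.Bijective g := by
    rw [Fintype.bijective_iff_injective_and_card]
    refine ⟨hinj, ?_⟩
    rw [Fintype.card_prod, ZMod.card, ← Nat.card_eq_fintype_card, hcard, pow_two]
  intro a ha
  obtain ⟨⟨k, l⟩, hkl⟩ := hbij.2 ⟨a, ha⟩
  exact ⟨k.val, l.val, by simpa [g] using (congrArg Subtype.val hkl).symm⟩

/-! ### (H): no idempotents forces `p ∣ n → p ∣ t` -/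

/-- **If `A = O / p O` has no non-trivial idempotent then `p ∣ n(x)` implies `p ∣ t(x)`**:
otherwise `t⁻¹ res x` is an idempotent, non-zero (as `res x ≠ 0`: `x ∈ p O` would give
`p ∣ t(x)`), and `≠ 1` (else `x ≡ t · 1` has norm `≡ t² ≢ 0`). [folklore] -/
theorem dvd_trdZ_of_no_idempotent (hO : IsZOrder O) (hp : p.Prime)
    (hno : ∀ e : hO.Residue p, IsIdempotentElem e → e = 0 ∨ e = 1)
    (x : hO.subring) (hn : (p : ℤ) ∣ nrdZ (x : B)) : (p : ℤ) ∣ trdZ (x : B) := by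
  by_contra ht
  have hpZ : Prime (p : ℤ) := Nat.prime_iff_prime_int.mp hp
  set t : ℤ := trdZ (x : B) with ht_def
  have hx0 : hO.res p x ≠ 0 := fun h0 => ht (by
    obtain ⟨y, hy, hxy⟩ := (Submodule.mem_smul_pointwise_iff_exists _ _ O).mp (res_eq_zero_iff.mp h0)
    rw [ht_def, ← hxy, hO.trdZ_zsmul _ hy]
    exact dvd_mul_right _ _)
  have hn0 : (nrdZ (x : B) : hO.Residue p) = 0 := (hO.intCast_residue_eq_zero_iff hp).mpr hn
  have hsq : hO.res p x * hO.res p x = (t : hO.Residue p) * hO.res p x := by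
    rw [hO.res_mul_res, hn0, sub_zero]
  obtain ⟨k, hk⟩ := hO.exists_intCast_mul_eq_one hp ht
  have hk' : (t : hO.Residue p) * (k : hO.Residue p) = 1 := by
    rw [(Int.cast_commute t (k : hO.Residue p)).eq, hk]
  have hzk : hO.res p x = (t : hO.Residue p) * ((k : hO.Residue p) * hO.res p x) := by
    rw [← mul_assoc, hk', one_mul]
  have hidem : IsIdempotentElem ((k : hO.Residue p) * hO.res p x) := by
    change (k : hO.Residue p) * hO.res p x * ((k : hO.Residue p) * hO.res p x) =
      (k : hO.Residue p) * hO.res p x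
    have hck : hO.res p x * (k : hO.Residue p) = (k : hO.Residue p) * hO.res p x :=
      ((Int.cast_commute k (hO.res p x)).eq).symm
    calc (k : hO.Residue p) * hO.res p x * ((k : hO.Residue p) * hO.res p x)
        = (k : hO.Residue p) * (hO.res p x * (k : hO.Residue p)) * hO.res p x := by noncomm_ring
      _ = (k : hO.Residue p) * ((k : hO.Residue p) * hO.res p x) * hO.res p x := by rw [hck]
      _ = (k : hO.Residue p) * (k : hO.Residue p) * (hO.res p x * hO.res p x) := by noncomm_ring
      _ = (k : hO.Residue p) * (k : hO.Residue p) * ((t : hO.Residue p) * hO.res p x) := by rw [hsq]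
      _ = (k : hO.Residue p) * ((k : hO.Residue p) * (t : hO.Residue p)) * hO.res p x := by noncomm_ring
      _ = (k : hO.Residue p) * hO.res p x := by rw [hk, mul_one]
  rcases hno _ hidem with h | h
  · exact hx0 (by rw [hzk, h, mul_zero])
  · have hz : hO.res p x = hO.res p (t : hO.subring) := by rw [hzk, h, mul_one, map_intCast]
    rw [res_eq_res_iff, Subring.coe_intCast] at hz
    obtain ⟨w, hw, hxw⟩ := (Submodule.mem_smul_pointwise_iff_exists _ _ O).mp hz
    have hxeq : (x : B) = (t : ℤ) • (1 : B) + (p : ℤ) • w := by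
      rw [hxw, zsmul_eq_mul, mul_one, add_sub_cancel]
    have hnrd := congrArg nrdZ hxeq
    rw [hO.nrdZ_add (O.smul_mem _ hO.one_mem) (O.smul_mem _ hw), hO.nrdZ_intCast,
      hO.nrdZ_zsmul _ hw, hO.polZ_zsmul _ _ hO.one_mem hw] at hnrd
    apply ht
    have h2 : (p : ℤ) ∣ t ^ 2 := by
      have : t ^ 2 = nrdZ (x : B) - (p : ℤ) * ((p : ℤ) * nrdZ w + t * polZ 1 w) := by
        rw [hnrd]; ring
      rw [this]
      exact dvd_sub hn (dvd_mul_right _ _)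
    exact hpZ.dvd_of_dvd_pow h2

/-! ### The norm lattice `𝔓 = {x ∈ O | p ∣ n(x)}` -/

/-- **The norm lattice** `𝔓 = {x ∈ O | p ∣ n(x)}` of an order whose residue ring satisfies (H)
`p ∣ n(x) → p ∣ t(x)` (it is then closed under addition by the polarisation identity). For a
maximal order without residual idempotents this is the unique maximal two-sided ideal above `p`
(Vignéras II §1: `P = {h : n(h) ∈ πR}`). [cite: VignerasLNM800, Ch. II §1 Lemme 1.5] -/
def normLattice (hO : IsZOrder O) (p : ℕ)
    (hH : ∀ x : hO.subring, (p : ℤ) ∣ nrdZ (x : B) → (p : ℤ) ∣ trdZ (x : B)) : Submodule ℤ B where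
  carrier := {x | ∃ _ : x ∈ O, (p : ℤ) ∣ nrdZ x}
  add_mem' := by
    rintro x y ⟨hx, hnx⟩ ⟨hy, hny⟩
    refine ⟨O.add_mem hx hy, ?_⟩
    rw [hO.nrdZ_add hx hy, polZ]
    have htx := hH ⟨x, hx⟩ hnx
    have hxy : (p : ℤ) ∣ trdZ (x * y) :=
      hH ⟨x * y, hO.mul_mem _ hx _ hy⟩ (by rw [hO.nrdZ_mul hx hy]; exact dvd_mul_of_dvd_left hnx _)
    exact dvd_add (dvd_add hnx hny) (dvd_sub (dvd_mul_of_dvd_left htx _) hxy)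
  zero_mem' := ⟨O.zero_mem, by rw [nrdZ_zero]; exact dvd_zero _⟩
  smul_mem' := by
    rintro c x ⟨hx, hnx⟩
    exact ⟨O.smul_mem c hx, by rw [hO.nrdZ_zsmul c hx]; exact dvd_mul_of_dvd_right hnx _⟩

variable {hO : IsZOrder O}
  {hH : ∀ x : hO.subring, (p : ℤ) ∣ nrdZ (x : B) → (p : ℤ) ∣ trdZ (x : B)}

/-- Membership in the norm lattice (definitional). [folklore] -/
theorem mem_normLattice {x : B} : x ∈ hO.normLattice p hH ↔ ∃ _ : x ∈ O, (p : ℤ) ∣ nrdZ x := Iff.rfl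

/-- `𝔓 ≤ O`. [folklore] -/
theorem normLattice_le : hO.normLattice p hH ≤ O := fun _ ⟨hx, _⟩ => hx

/-- `p O ≤ 𝔓` (`n(p y) = p² n(y)`). [folklore] -/
theorem smul_le_normLattice : (p : ℤ) • O ≤ hO.normLattice p hH := fun x hx => by
  obtain ⟨y, hy, rfl⟩ := (Submodule.mem_smul_pointwise_iff_exists _ _ O).mp hx
  exact ⟨O.smul_mem _ hy, by rw [hO.nrdZ_zsmul _ hy, pow_two, mul_assoc]; exact dvd_mul_right _ _⟩

/-- `𝔓` is a two-sided ideal of `O` (`n` is multiplicative). [folklore] -/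
theorem mul_mem_normLattice {x y : B} (hx : x ∈ O) (hy : y ∈ hO.normLattice p hH) :
    x * y ∈ hO.normLattice p hH ∧ y * x ∈ hO.normLattice p hH := by
  obtain ⟨hyO, hny⟩ := hy
  exact ⟨⟨hO.mul_mem _ hx _ hyO, by rw [hO.nrdZ_mul hx hyO]; exact dvd_mul_of_dvd_right hny _⟩,
    ⟨hO.mul_mem _ hyO _ hx, by rw [hO.nrdZ_mul hyO hx]; exact dvd_mul_of_dvd_left hny _⟩⟩

/-- `1 ∉ 𝔓` (`n(1) = 1`), for `p` prime. [folklore] -/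
theorem one_not_mem_normLattice (hp : p.Prime) : (1 : B) ∉ hO.normLattice p hH := fun ⟨_, h⟩ => by
  rw [nrdZ_one] at h
  exact hp.one_lt.ne' (by exact_mod_cast Int.eq_one_of_dvd_one (by positivity) h)

/-- **Elements outside `𝔓` are invertible modulo `p O`**: if `x ∈ O ∖ 𝔓` there is `w ∈ O` with
`x w − 1, w x − 1 ∈ p O` (`w = k x̄`, `k n(x) ≡ 1`). [cite: VignerasLNM800, Ch. II §1 Lemme 1.5] -/
theorem exists_inv_mod_of_not_mem_normLattice (hp : p.Prime) {x : B} (hx : x ∈ O)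
    (hxP : x ∉ hO.normLattice p hH) :
    ∃ w ∈ O, x * w - 1 ∈ (p : ℤ) • O ∧ w * x - 1 ∈ (p : ℤ) • O := by
  have hn : ¬ (p : ℤ) ∣ nrdZ x := fun h => hxP ⟨hx, h⟩
  obtain ⟨l, hl⟩ := hO.exists_intCast_mul_eq_one hp hn
  let ws : hO.subring := (l : hO.subring) * hO.barS ⟨x, hx⟩
  refine ⟨ws, ws.2, ?_, ?_⟩
  · have h : hO.res p (⟨x, hx⟩ * ws - 1) = 0 := by
      rw [map_sub, map_mul, map_one]
      change hO.res p ⟨x, hx⟩ * hO.res p ((l : hO.subring) * hO.barS ⟨x, hx⟩) - 1 = 0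
      rw [map_mul, map_intCast, ← mul_assoc, ← (Int.cast_commute l _).eq, mul_assoc, res_mul_res_barS,
        hl, sub_self]
    simpa only [AddSubgroupClass.coe_sub, Subring.coe_mul, Subring.coe_one] using res_eq_zero_iff.mp h
  · have h : hO.res p (ws * ⟨x, hx⟩ - 1) = 0 := by
      rw [map_sub, map_mul, map_one]
      change hO.res p ((l : hO.subring) * hO.barS ⟨x, hx⟩) * hO.res p ⟨x, hx⟩ - 1 = 0
      rw [map_mul, map_intCast, mul_assoc, res_barS_mul_res, hl, sub_self]
    simpa only [AddSubgroupClass.coe_sub, Subring.coe_mul, Subring.coe_one] using res_eq_zero_iff.mp h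

/-- **Elements of `𝔓` square to zero in `A`** (`t ≡ n ≡ 0`). [folklore] -/
theorem res_mul_self_of_mem_normLattice (hp : p.Prime) {x : hO.subring}
    (hx : (x : B) ∈ hO.normLattice p hH) : hO.res p x * hO.res p x = 0 := by
  obtain ⟨_, hn⟩ := hx
  rw [hO.res_mul_res, (hO.intCast_residue_eq_zero_iff hp).mpr hn,
    (hO.intCast_residue_eq_zero_iff hp).mpr (hH x hn), zero_mul, sub_zero]

/-! ### The image `Z ⊆ A` of `𝔓` and its cardinality -/

/-- The image `Z = res(𝔓) ⊆ A = O / p O` of the norm lattice, as an additive subgroup. [folklore] -/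
def normResidue (hO : IsZOrder O) (p : ℕ)
    (hH : ∀ x : hO.subring, (p : ℤ) ∣ nrdZ (x : B) → (p : ℤ) ∣ trdZ (x : B)) :
    AddSubgroup (hO.Residue p) :=
  ((hO.normLattice p hH).toAddSubgroup.comap (hO.subring.subtype : hO.subring →+ B)).map (hO.res p)

/-- Membership in `Z` (unfolding). [folklore] -/
theorem mem_normResidue_iff {z : hO.Residue p} :
    z ∈ hO.normResidue p hH ↔ ∃ y : hO.subring, (y : B) ∈ hO.normLattice p hH ∧ hO.res p y = z := by
  constructor
  · rintro ⟨y, hy, rfl⟩; exact ⟨y, hy, rfl⟩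
  · rintro ⟨y, hy, rfl⟩; exact ⟨y, hy, rfl⟩

/-- **Membership in `Z`**: `res x ∈ Z ↔ x ∈ 𝔓` (as `p O ⊆ 𝔓`). [folklore] -/
theorem res_mem_normResidue_iff {x : hO.subring} :
    hO.res p x ∈ hO.normResidue p hH ↔ (x : B) ∈ hO.normLattice p hH := by
  constructor
  · intro h
    obtain ⟨y, hy, hxy⟩ := mem_normResidue_iff.mp h
    have hdiff : (x : B) - y ∈ (p : ℤ) • O := res_eq_res_iff.mp hxy.symm
    have : (x : B) = ((x : B) - y) + y := by abel
    rw [this]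
    exact Submodule.add_mem _ (smul_le_normLattice hdiff) hy
  · intro hx
    exact mem_normResidue_iff.mpr ⟨x, hx, rfl⟩

/-- `Z` is a two-sided ideal of `A`: `a z, z a ∈ Z`. [folklore] -/
theorem mul_mem_normResidue (a : hO.Residue p) {z : hO.Residue p} (hz : z ∈ hO.normResidue p hH) :
    a * z ∈ hO.normResidue p hH ∧ z * a ∈ hO.normResidue p hH := by
  obtain ⟨x, rfl⟩ := hO.res_surjective p a
  obtain ⟨y, hy, rfl⟩ := mem_normResidue_iff.mp hz
  refine ⟨?_, ?_⟩
  · rw [← map_mul, res_mem_normResidue_iff]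
    exact (mul_mem_normLattice x.2 hy).1
  · rw [← map_mul, res_mem_normResidue_iff]
    exact (mul_mem_normLattice x.2 hy).2

/-- Elements of `Z` square to zero. [folklore] -/
theorem mul_self_of_mem_normResidue (hp : p.Prime) {z : hO.Residue p} (hz : z ∈ hO.normResidue p hH) :
    z * z = 0 := by
  obtain ⟨y, hy, rfl⟩ := mem_normResidue_iff.mp hz
  exact res_mul_self_of_mem_normLattice hp hy

/-- `1 ∉ Z`. [folklore] -/
theorem one_not_mem_normResidue (hp : p.Prime) : (1 : hO.Residue p) ∉ hO.normResidue p hH := fun h => by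
  rw [← map_one (hO.res p), res_mem_normResidue_iff, Subring.coe_one] at h
  exact one_not_mem_normLattice hp h

/-- **Elements outside `Z` are units of `A`.** [folklore] -/
theorem isUnit_of_not_mem_normResidue (hp : p.Prime) {a : hO.Residue p} (ha : a ∉ hO.normResidue p hH) :
    IsUnit a := by
  obtain ⟨x, rfl⟩ := hO.res_surjective p a
  rw [res_mem_normResidue_iff] at ha
  have hn : ¬ (p : ℤ) ∣ nrdZ (x : B) := fun h => ha ⟨x.2, h⟩
  exact hO.isUnit_res_of_not_dvd hp hn

/-- **`|Z| · [O : 𝔓] = p⁴`** (`Z ≅ 𝔓 / p O`, `|A| = p⁴`). [folklore] -/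
theorem card_normResidue_mul_relIndex (hp : p.Prime) :
    Nat.card (hO.normResidue p hH) * (hO.normLattice p hH).toAddSubgroup.relIndex O.toAddSubgroup = p ^ 4 := by
  -- `Z.comap res = 𝔓 ∩ O` inside the subring, whose index is `[O : 𝔓]`
  set P := (hO.normLattice p hH).toAddSubgroup.comap (hO.subring.subtype : hO.subring →+ B) with hP
  have hker : (hO.res p).toAddMonoidHom.ker ≤ P := fun x hx => by
    change hO.res p x = 0 at hx
    exact (smul_le_normLattice (hO := hO) (hH := hH) (res_eq_zero_iff.mp hx) :
      (x : B) ∈ hO.normLattice p hH)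
  have hcomap : (hO.normResidue p hH).comap (hO.res p).toAddMonoidHom = P := by
    rw [normResidue, ← hP]
    exact AddSubgroup.comap_map_eq_self hker
  have hindex : P.index = (hO.normResidue p hH).index := by
    rw [← hcomap, AddSubgroup.index_comap_of_surjective _ (hO.res_surjective p)]
  have hrange : (hO.subring.subtype : hO.subring →+ B).range = O.toAddSubgroup := by
    ext x; constructor
    · rintro ⟨y, rfl⟩; exact y.2
    · intro hx; exact ⟨⟨x, hx⟩, rfl⟩
  have hP' : P.index = (hO.normLattice p hH).toAddSubgroup.relIndex O.toAddSubgroup := by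
    rw [hP, AddSubgroup.index_comap, hrange]
  rw [← hP', hindex, AddSubgroup.card_mul_index, hO.card_residue hp.ne_zero]

/-- `|Z|` is a power of `p`, at least `p` (it contains the isotropic vector) and less than `p⁴`
(`1 ∉ Z`). [folklore] -/
theorem card_normResidue_cases (hp : p.Prime) :
    ∃ i, 1 ≤ i ∧ i ≤ 3 ∧ Nat.card (hO.normResidue p hH) = p ^ i := by
  obtain ⟨i, hi4, hi⟩ := hO.card_addSubgroup_residue hp (hO.normResidue p hH)
  refine ⟨i, ?_, ?_, hi⟩
  · -- the isotropic vector gives a non-zero element of `Z`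
    obtain ⟨x, hx0, hdvd⟩ := hO.exists_res_ne_zero_dvd_nrdZ hp
    have hmem : hO.res p x ∈ hO.normResidue p hH := res_mem_normResidue_iff.mpr ⟨x.2, hdvd⟩
    have := hO.dvd_card_of_ne_zero_mem hp hmem hx0
    rw [hi] at this
    rcases Nat.eq_zero_or_pos i with rfl | h
    · rw [pow_zero, Nat.dvd_one] at this; exact absurd this hp.one_lt.ne'
    · exact h
  · by_contra h4
    have : i = 4 := by omega
    subst this
    haveI : Finite (hO.normResidue p hH) :=
      Nat.finite_of_card_ne_zero (by rw [hi]; exact pow_ne_zero 4 hp.ne_zero)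
    have htop := (AddSubgroup.card_eq_iff_eq_top (hO.normResidue p hH)).mp
      (by rw [hi, hO.card_residue hp.ne_zero])
    exact one_not_mem_normResidue hp (htop ▸ AddSubgroup.mem_top 1)

/-! ### `|Z| = p` is impossible -/

/-- **`|Z| = p` cannot happen**: then `Z = ℤ z₀` and every `a ∈ A` has `a z₀ = k z₀`, so
`a − k ∈ Z` (a non-member would be a unit killing `z₀`), i.e. `A = ℤ + Z` has at most `p · p`
elements — not `p⁴`. [folklore] -/
theorem card_normResidue_ne (hp : p.Prime) : Nat.card (hO.normResidue p hH) ≠ p := by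
  intro hcard
  classical
  haveI : Fact p.Prime := ⟨hp⟩
  set Z := hO.normResidue p hH
  obtain ⟨x, hx0, hdvd⟩ := hO.exists_res_ne_zero_dvd_nrdZ hp
  set z₀ := hO.res p x
  have hz₀ : z₀ ∈ Z := res_mem_normResidue_iff.mpr ⟨x.2, hdvd⟩
  have hline := hO.addSubgroup_eq_zmultiples hp hz₀ hx0 hcard
  -- every `a` is `k + z` with `z ∈ Z`
  have hdecomp : ∀ a : hO.Residue p, ∃ k : ℤ, a - (k : hO.Residue p) ∈ Z := fun a => by
    obtain ⟨k, hk⟩ := hline _ (mul_mem_normResidue a hz₀).1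
    refine ⟨k, ?_⟩
    by_contra hnot
    obtain ⟨u, hu⟩ := (isUnit_of_not_mem_normResidue hp hnot).exists_left_inv
    apply hx0
    have h0 : (a - (k : hO.Residue p)) * z₀ = 0 := by rw [sub_mul, ← hk, sub_self]
    calc z₀ = u * (a - (k : hO.Residue p)) * z₀ := by rw [hu, one_mul]
      _ = 0 := by rw [mul_assoc, h0, mul_zero]
  -- so `(k, z) ↦ k + z` maps `ZMod p × Z` onto `A`
  haveI : Finite Z := Nat.finite_of_card_ne_zero (by rw [hcard]; exact hp.ne_zero)
  have hsurj : Function.Surjective (fun kz : ZMod p × Z => ((kz.1.val : ℤ) : hO.Residue p) + kz.2) := by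
    intro a
    obtain ⟨k, hk⟩ := hdecomp a
    refine ⟨((k : ZMod p), ⟨a - (k : hO.Residue p), hk⟩), ?_⟩
    simp only
    have : (k : hO.Residue p) = (((k : ZMod p).val : ℤ) : hO.Residue p) := by
      rw [ZMod.val_intCast, ← sub_eq_zero, ← Int.cast_sub, hO.intCast_residue_eq_zero_iff hp]
      exact Int.dvd_self_sub_emod
    rw [← this, add_sub_cancel]
  have hle := Nat.card_le_card_of_surjective _ hsurj
  rw [Nat.card_prod, Nat.card_zmod, hcard, hO.card_residue hp.ne_zero] at hle
  have : p * p < p ^ 4 := by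
    calc p * p = p ^ 2 := (pow_two p).symm
      _ < p ^ 4 := Nat.pow_lt_pow_right hp.one_lt (by norm_num)
  omega

end IsZOrder

end Literature.NumberTheory.Automorphic

end
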